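import Literature.MathematicalPhysics.KineticTheory.HardSphereBBGKYLiouvilleHolds
import HarnessLib

/-!
# `liouville_imp_bbgky` holds (K3): from the Liouville equation to the mild BBGKY hierarchy

Discharge of the named fact `Literature.Analysis.FluidPDE.liouville_imp_bbgky` of
`Literature.Analysis.FluidPDE.BBGKYMarginals` (GST 2013 §4.3; CIP 1994 Thm 4.3.1): it is, binder for
binder, the statement-layer fact `Literature.MathematicalPhysics.KineticTheory.bbgky_hierarchy_of_liouville`
(**hilbert6.S07**; `bbgky_hierarchy_of_liouville_iff_liouville_imp_bbgky`), proved in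
`Literature.MathematicalPhysics.KineticTheory.HardSphereBBGKYLiouvilleHolds`
(`bbgky_hierarchy_of_liouville_holds`; see that file and `HardSphereBBGKYLiouvilleFlow` for the
plan of the proof and the honesty note on the strength of the statement: the versions are free on
null sets, and the boundary values fed to the collision operator are not the physical trace — the
physical a.e. hierarchy `MildBBGKYae` of `LiouvilleBBGKY` remains open).

## References

* C. Cercignani, R. Illner, M. Pulvirenti, *The Mathematical Theory of Dilute Gases*, Springer
  (1994), §4.3, Thm 4.3.1.
* I. Gallagher, L. Saint-Raymond, B. Texier, *From Newton to Boltzmann*, EMS (2013),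
  arXiv:1208.5753, §4.3.
-/

namespace Literature.Analysis.FluidPDE

variable {d : Type*} [Fintype d]

/-- **K3's `liouville_imp_bbgky` holds** (GST 2013 §4.3; CIP 1994 Thm 4.3.1): discharge of the
named fact, through its identification with **hilbert6.S07**
(`bbgky_hierarchy_of_liouville_iff_liouville_imp_bbgky`) and the proof
`bbgky_hierarchy_of_liouville_holds`. [cite: CIP1994, Thm 4.3.1] -/
theorem liouville_imp_bbgky_holds : liouville_imp_bbgky (d := d) :=
  Literature.MathematicalPhysics.KineticTheory.bbgky_hierarchy_of_liouville_iff_liouville_imp_bbgky.1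
    Literature.MathematicalPhysics.KineticTheory.bbgky_hierarchy_of_liouville_holds

end Literature.Analysis.FluidPDE
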